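import Mathlib
import Summits.ValiantsHypothesis.ValiantsHypothesis.Theses.DivisionGap

/-!
# Crux-triage r1 / triager 1 — degenerate-case checks of the ideators' first lemmas
(crux `ShadowBirkhoff`, stmt-ValiantsHypothesis-5069)

All definitions below are VERBATIM copies from the ideators' published sketches
(`Cruxes/ShadowBirkhoff/Sketch-ideator1.lean`, `Sketch-ideator2.lean`, `SketchIdeator3.lean`),
re-declared in a scratch namespace so that this file is self-contained.

Findings (all sorry-free):
* `counterFace_hyp_false` — the hypothesis `∀ m ≥ 1, CounterFace m (m ^ d)` of
  `shadowBirkhoff_of_counterFace` (card parabola-register-face) is unsatisfiable for every `d`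
  (at `m = 1`, `N = 1`, `S_1` has one element): the reduction as typed is vacuous.
  Repair: `∃ d m₀, ∀ m ≥ m₀, CounterFace m (m ^ d)`.
* `not_dominoShadow` — the transfer target `DominoShadow` (card polytrope-kr-planar-dimers) is
  FALSE as typed: an odd board has no domino tiling, the point set is empty, the count is `0`.
  Repair: quantify over even side lengths (`∀ m ≥ m₀, Even m → …` or boards `2m × 2m`).
* `gridDimerShadow_trivial` — the transfer target `GridDimerShadow` (card planar-transport-transfer)
  is TRIVIALLY TRUE as typed: nothing forces the family `ρs` to be injective (on black cells), so a
  CONSTANT family (one brick tiling, uniquely optimal for the weight "0 on its dominoes, 1 elsewhere")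
  of any length `m` satisfies it.  Hence `shadowBirkhoff_of_gridDimerShadow` is exactly as hard as
  the crux.  Repair: add `∀ i j, (∀ u, IsBlack u → ρs i u = ρs j u) → i = j`.
-/

noncomputable section

open scoped BigOperators

namespace CruxTriageR1K1

/-- probe: the crux decl elaborates. -/
theorem probe : Summit.ValiantsHypothesis.ValiantsHypothesis.Theses.DivisionGap.ShadowBirkhoff := by
  sorry

/-! ## 1. parabola-register-face: `CounterFace` (verbatim, Sketch-ideator1.lean) -/

def CounterFace (m N : ℕ) : Prop :=
  ∃ (G : Set (Fin N × Fin N)) (wa wb : Fin N × Fin N → ℝ),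
    (∀ ρ : Equiv.Perm (Fin N), (∀ j, (ρ j, j) ∈ G) →
        (∑ j, wb (ρ j, j)) ^ 2 ≤ ∑ j, wa (ρ j, j)) ∧
    2 ^ m ≤ {t : ℝ | ∃ ρ : Equiv.Perm (Fin N), (∀ j, (ρ j, j) ∈ G) ∧
        ∑ j, wb (ρ j, j) = t ∧ ∑ j, wa (ρ j, j) = t ^ 2}.ncard

/-- `CounterFace m 1` fails for every `m ≥ 1`: `S_1` is a singleton, so at most one value `t`. -/
theorem not_counterFace_one (m : ℕ) (hm : 1 ≤ m) : ¬ CounterFace m 1 := by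
  rintro ⟨G, wa, wb, -, h⟩
  have hsub : {t : ℝ | ∃ ρ : Equiv.Perm (Fin 1), (∀ j, (ρ j, j) ∈ G) ∧
      ∑ j, wb (ρ j, j) = t ∧ ∑ j, wa (ρ j, j) = t ^ 2} ⊆ {∑ j : Fin 1, wb (j, j)} := by
    rintro t ⟨ρ, -, ht, -⟩
    rw [Set.mem_singleton_iff, ← ht]
    refine Finset.sum_congr rfl fun j _ => ?_
    rw [Subsingleton.elim (ρ j) j]
  have h1 := Set.ncard_le_ncard hsub (Set.finite_singleton _)
  rw [Set.ncard_singleton] at h1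
  have h2 : 2 ≤ 2 ^ m := by
    calc 2 = 2 ^ 1 := by norm_num
      _ ≤ 2 ^ m := Nat.pow_le_pow_right (by norm_num) hm
  omega

/-- The hypothesis of `shadowBirkhoff_of_counterFace (d) (h : ∀ m, 1 ≤ m → CounterFace m (m ^ d))`
is unsatisfiable for EVERY `d` (take `m = 1`, `N = 1 ^ d = 1`). -/
theorem counterFace_hyp_false (d : ℕ) : ¬ ∀ m : ℕ, 1 ≤ m → CounterFace m (m ^ d) := by
  intro h
  have h1 := h 1 le_rfl
  rw [one_pow] at h1
  exact not_counterFace_one 1 le_rfl h1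

/-! ## 2. polytrope-kr-planar-dimers: `DominoShadow` (verbatim, Sketch-ideator2.lean) -/

def IsGridAdjacent {m : ℕ} (v w : Fin m × Fin m) : Prop :=
  (((v.1 : ℕ) + 1 = w.1 ∧ v.2 = w.2) ∨ ((w.1 : ℕ) + 1 = v.1 ∧ v.2 = w.2) ∨
    (v.1 = w.1 ∧ (v.2 : ℕ) + 1 = w.2) ∨ (v.1 = w.1 ∧ (w.2 : ℕ) + 1 = v.2))

def dominoPoints (m : ℕ) : Set ((Fin m × Fin m) × (Fin m × Fin m) → ℝ) :=
  {x | ∃ f : Fin m × Fin m → Fin m × Fin m,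
    (∀ v, f (f v) = v ∧ f v ≠ v ∧ IsGridAdjacent v (f v)) ∧ x = fun e => if f e.1 = e.2 then 1 else 0}

def DominoShadow : Prop :=
  ∀ c : ℕ, ∃ m₀ : ℕ, ∀ m ≥ m₀,
    ∃ L : (((Fin m × Fin m) × (Fin m × Fin m)) → ℝ) →ₗ[ℝ] (Fin 2 → ℝ),
      2 ^ ((Nat.log 2 m + c) ^ c) < (Set.extremePoints ℝ (convexHull ℝ (L '' dominoPoints m))).ncard

/-- An odd board has no domino tiling (no fixed-point-free involution on a set of odd size). -/
theorem dominoPoints_eq_empty_of_odd (m : ℕ) (hm : Odd m) : dominoPoints m = ∅ := by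
  ext x
  simp only [dominoPoints, Set.mem_setOf_eq, Set.mem_empty_iff_false, iff_false, not_exists,
    not_and]
  intro f hf _
  have hinv : Function.Involutive f := fun v => (hf v).1
  have hsq : Function.Involutive.toPerm f hinv ^ 2 = 1 := by
    ext v : 1
    simp [sq, hinv v]
  have hsupp : (Function.Involutive.toPerm f hinv).support = Finset.univ := by
    ext v
    simp [Equiv.Perm.mem_support, (hf v).2.1]
  have h2 := Equiv.Perm.two_dvd_card_support hsq
  rw [hsupp, Finset.card_univ, Fintype.card_prod, Fintype.card_fin] at h2
  have hodd : Odd (m * m) := hm.mul hm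
  exact (Nat.not_even_iff_odd.2 hodd) (even_iff_two_dvd.2 h2)

/-- `DominoShadow` as typed is FALSE: at odd `m` the point set is empty and the count is `0`. -/
theorem not_dominoShadow : ¬ DominoShadow := by
  intro h
  obtain ⟨m₀, hm₀⟩ := h 0
  obtain ⟨L, hL⟩ := hm₀ (2 * m₀ + 1) (by omega)
  rw [dominoPoints_eq_empty_of_odd _ ⟨m₀, rfl⟩, Set.image_empty, convexHull_empty,
    extremePoints_empty, Set.ncard_empty] at hL
  exact absurd hL (Nat.not_lt.2 (Nat.zero_le _))

/-! ## 3. planar-transport-transfer: `GridDimerShadow` (verbatim, SketchIdeator3.lean) -/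

def GridAdj {m : ℕ} (u v : Fin m × Fin m) : Prop :=
  (u.1 = v.1 ∧ ((u.2 : ℕ) + 1 = v.2 ∨ (v.2 : ℕ) + 1 = u.2)) ∨
  (u.2 = v.2 ∧ ((u.1 : ℕ) + 1 = v.1 ∨ (v.1 : ℕ) + 1 = u.1))

def IsBlack {m : ℕ} (u : Fin m × Fin m) : Prop := ((u.1 : ℕ) + (u.2 : ℕ)) % 2 = 0

open Classical in
noncomputable def blackCost {m : ℕ} (w : Fin m × Fin m → Fin m × Fin m → ℝ × ℝ)
    (ρ : Equiv.Perm (Fin m × Fin m)) (t : ℝ) : ℝ :=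
  ∑ u, if IsBlack u then (w u (ρ u)).1 + t * (w u (ρ u)).2 else 0

def GridDimerShadow : Prop :=
  ∀ c : ℕ, ∃ k₀ : ℕ, ∀ k ≥ k₀,
    ∃ w : Fin (2 * k) × Fin (2 * k) → Fin (2 * k) × Fin (2 * k) → ℝ × ℝ, ∃ m : ℕ,
      2 ^ ((Nat.log 2 (2 * k) + c) ^ c) < m ∧
      ∃ ρs : Fin m → Equiv.Perm (Fin (2 * k) × Fin (2 * k)), ∃ ts : Fin m → ℝ,
        (∀ i u, GridAdj u (ρs i u)) ∧
        ∀ i (ρ : Equiv.Perm (Fin (2 * k) × Fin (2 * k))), (∀ u, GridAdj u (ρ u)) →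
          (∃ u, IsBlack u ∧ ρ u ≠ ρs i u) → blackCost w (ρs i) (ts i) < blackCost w ρ (ts i)

/-- Column partner `b ↦ b xor 1` on `Fin (2k)` (horizontal bricks). -/
def partner (k : ℕ) (b : Fin (2 * k)) : Fin (2 * k) :=
  ⟨if (b : ℕ) % 2 = 0 then b + 1 else b - 1, by
    have := b.isLt
    split_ifs with h <;> omega⟩

theorem partner_val (k : ℕ) (b : Fin (2 * k)) :
    ((partner k b : Fin (2 * k)) : ℕ) = if (b : ℕ) % 2 = 0 then (b : ℕ) + 1 else (b : ℕ) - 1 := rfl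

theorem partner_partner (k : ℕ) (b : Fin (2 * k)) : partner k (partner k b) = b := by
  apply Fin.ext
  rw [partner_val, partner_val]
  have := b.isLt
  split_ifs with h1 h2 h2 <;> omega

theorem partner_ne (k : ℕ) (b : Fin (2 * k)) : partner k b ≠ b := by
  intro h
  have h' := congrArg Fin.val h
  rw [partner_val] at h'
  split_ifs at h' with h1 <;> omega

/-- The brick tiling as a permutation of the cells: `(a, b) ↦ (a, b xor 1)`. -/
def brickFun (k : ℕ) (u : Fin (2 * k) × Fin (2 * k)) : Fin (2 * k) × Fin (2 * k) :=
  (u.1, partner k u.2)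

theorem brickFun_involutive (k : ℕ) : Function.Involutive (brickFun k) := fun u => by
  simp only [brickFun, partner_partner]

def brick (k : ℕ) : Equiv.Perm (Fin (2 * k) × Fin (2 * k)) :=
  Function.Involutive.toPerm (brickFun k) (brickFun_involutive k)

theorem brick_apply (k : ℕ) (u : Fin (2 * k) × Fin (2 * k)) : brick k u = (u.1, partner k u.2) :=
  rfl

theorem brick_gridAdj (k : ℕ) (u : Fin (2 * k) × Fin (2 * k)) : GridAdj u (brick k u) := by
  rw [brick_apply]
  left
  refine ⟨rfl, ?_⟩
  show (u.2 : ℕ) + 1 = ((partner k u.2 : Fin (2 * k)) : ℕ) ∨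
    ((partner k u.2 : Fin (2 * k)) : ℕ) + 1 = (u.2 : ℕ)
  rw [partner_val]
  have := u.2.isLt
  split_ifs with h <;> omega

/-- The weight table making the brick tiling the strict unique optimum: `0` on its dominoes,
`1` elsewhere (second coordinates all `0`). -/
def trivW (k : ℕ) (u v : Fin (2 * k) × Fin (2 * k)) : ℝ × ℝ :=
  if v = brick k u then (0, 0) else (1, 0)

theorem trivW_fst_nonneg (k : ℕ) (u v : Fin (2 * k) × Fin (2 * k)) : 0 ≤ (trivW k u v).1 := by
  unfold trivW; split_ifs <;> norm_num

theorem trivW_snd (k : ℕ) (u v : Fin (2 * k) × Fin (2 * k)) : (trivW k u v).2 = 0 := by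
  unfold trivW; split_ifs <;> rfl

theorem trivW_brick (k : ℕ) (u : Fin (2 * k) × Fin (2 * k)) : trivW k u (brick k u) = (0, 0) := by
  unfold trivW; rw [if_pos rfl]

theorem trivW_of_ne (k : ℕ) (u v : Fin (2 * k) × Fin (2 * k)) (h : v ≠ brick k u) :
    trivW k u v = (1, 0) := by
  unfold trivW; rw [if_neg h]

/-- **`GridDimerShadow` is trivially true**: a constant family of any length works. -/
theorem gridDimerShadow_trivial : GridDimerShadow := by
  intro c
  refine ⟨0, fun k _ => ?_⟩
  refine ⟨trivW k, 2 ^ ((Nat.log 2 (2 * k) + c) ^ c) + 1, Nat.lt_succ_self _,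
    fun _ => brick k, fun _ => 0, fun _ u => brick_gridAdj k u, ?_⟩
  intro i ρ _hρ hex
  obtain ⟨u₀, hu₀, hne⟩ := hex
  simp only at hne
  classical
  have h0 : blackCost (trivW k) (brick k) 0 = 0 := by
    unfold blackCost
    refine Finset.sum_eq_zero fun u _ => ?_
    rw [trivW_brick]
    split_ifs <;> simp
  have hterm : ∀ u ∈ (Finset.univ : Finset (Fin (2 * k) × Fin (2 * k))),
      (0 : ℝ) ≤ (if IsBlack u then (trivW k u (ρ u)).1 + 0 * (trivW k u (ρ u)).2 else 0) := by
    intro u _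
    split_ifs
    · rw [zero_mul, add_zero]; exact trivW_fst_nonneg k u (ρ u)
    · exact le_rfl
  have h1 : (1 : ℝ) ≤ blackCost (trivW k) ρ 0 := by
    unfold blackCost
    refine le_trans ?_ (Finset.single_le_sum hterm (Finset.mem_univ u₀))
    rw [if_pos hu₀, trivW_of_ne k u₀ (ρ u₀) hne]
    norm_num
  rw [h0]
  linarith

end CruxTriageR1K1

end
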